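import Literature.MathematicalPhysics.QuantumFieldTheory.ConstructiveQFTWave0WilsonLoopRPProofs
import Literature.MathematicalPhysics.QuantumLattice.HeatKernelGroupGaugeProofs
import HarnessLib

/-!
# Flat lattice gauge fields on the discrete torus are gauge transforms of commuting seam
# configurations (axial gauge; torons)

For a group `G` (no topology needed) and a gauge configuration `U : GaugeConfig d L G` on the
discrete torus `(ℤ/L)^d`, the following are equivalent:

* `U` is **flat**: every plaquette holonomy is `1`;
* `U` is a gauge transform `gaugeTransform g (seamConfig L h)` of a **seam configuration** — the
  configuration that is `1` on every edge except the "wrapping" edges `(x, μ)` with `x_μ = L − 1`,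
  where it is `h μ` — for some site gauge `g` and a COMMUTING `d`-tuple `h : Fin d → G`
  (`h μ h ν = h ν h μ`), i.e. an element of `Hom(ℤ^d, G)`.

This is the lattice form of "flat `G`-connections on the torus `T^d` modulo gauge ↔ commuting
`d`-tuples (holonomies) modulo conjugation" (toron sectors; 't Hooft 1979, Lüscher 1983,
van Baal 2001 on the femto-universe; axial/maximal-tree gauge fixing: Creutz 1977/1983). It is the
starting point of every semiclassical (`β → ∞`, fixed torus) analysis of Wilson's measure, whose
mass concentrates on the flat variety.

## Main results

* `seamConfig L h`: the seam configuration of a tuple `h`.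
* `plaquetteHolonomy_seamConfig`: a commuting tuple gives a FLAT seam configuration.
* `axialHolonomy U x d`: holonomy of `U` along the lexicographic axial path `0 → x` (first
  `x₀` steps in direction `0`, then `x₁` steps in direction `1`, …, representatives in `[0, L)`).
* `axialGauge_apply_of_val_lt` : in the axial gauge `W := gaugeTransform (axialHolonomy U · d) U`
  of a flat `U`, every non-wrapping edge carries `1`.
* `axialGauge_apply_of_val_eq` : … and every wrapping edge `(x, μ)` carries the SAME element
  `W (Pi.single μ (-1), μ)`.
* `exists_gaugeTransform_seamConfig_of_flat`, `flat_iff_exists_gaugeTransform_seamConfig`: the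
  equivalence.

## Proof

Discrete Stokes: flatness slides a `μ`-step across any straight line
(`mul_lineHolonomy_shift_eq_of_flat`), hence across the axial staircase, so the axial holonomy to
`x + e_μ` is the axial holonomy to `x` followed by the edge `(x, μ)` whenever that edge does not
wrap (`axialHolonomy_add_single`); in the axial gauge the gauge-transformed field `W` (still flat,
`plaquetteHolonomy_gaugeTransform`) is therefore `1` off the seams, constant along each seam
(flatness of `W` at plaquettes with two trivial edges), and the `d` seam values commute (flatness of
`W` at a plaquette meeting two seams).

## References

* G. 't Hooft, *A property of electric and magnetic flux in non-abelian gauge theories*,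
  Nucl. Phys. B 153 (1979) 141.
* M. Lüscher, *Some analytic results concerning the mass spectrum of Yang–Mills gauge theories on
  a torus*, Nucl. Phys. B 219 (1983) 233, §2 (torons = constant abelian gauge potentials).
* M. Creutz, *Quarks, gluons and lattices* (1983), Ch. 9 (axial / maximal-tree gauge).
-/

noncomputable section

namespace Literature.MathematicalPhysics.QuantumFieldTheory

open Literature.MathematicalPhysics.QuantumLattice (plaquetteHolonomy_gaugeTransform)

variable {d L : ℕ} {G : Type*} [Group G]

/-! ## Seam configurations -/

variable (L) in
/-- The **seam configuration** of a tuple `h : Fin d → G` on the torus `(ℤ/L)^d`: the edge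
`(x, μ)` carries `h μ` if it wraps around the torus (`x_μ = L − 1`, i.e. `(x μ).val + 1 = L`) and
`1` otherwise (Lüscher's constant abelian potentials in lattice form). [folklore] -/
def seamConfig (h : Fin d → G) : GaugeConfig d L G :=
  fun e => if (e.1 e.2).val + 1 = L then h e.2 else 1

/-- The value of a seam configuration on an edge `(y, j)` only depends on the coordinate `y j`;
in particular shifting the base point in a direction `i ≠ j` does not change it. [folklore] -/
theorem seamConfig_shift_of_ne (h : Fin d → G) (y : Site d L) {i j : Fin d} (hij : i ≠ j) :
    seamConfig L h (y.shift i, j) = seamConfig L h (y, j) := by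
  simp only [seamConfig, Site.shift, Pi.add_apply, Pi.single_apply, if_neg hij.symm, add_zero]

/-- **A commuting tuple gives a flat seam configuration**: the plaquette at `x` in the `(i, j)`
plane reads `a b a⁻¹ b⁻¹` with `a ∈ {1, h i}`, `b ∈ {1, h j}`. [folklore] -/
theorem plaquetteHolonomy_seamConfig (h : Fin d → G) (hcomm : ∀ μ ν, h μ * h ν = h ν * h μ)
    (x : Site d L) (i j : Fin d) : plaquetteHolonomy (seamConfig L h) x i j = 1 := by
  by_cases hij : i = j
  · subst hij
    simp [plaquetteHolonomy]
  rw [plaquetteHolonomy, seamConfig_shift_of_ne h x hij, seamConfig_shift_of_ne h x (Ne.symm hij)]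
  -- `a * b * a⁻¹ * b⁻¹ = 1` for commuting `a`, `b`
  have hab : seamConfig L h (x, i) * seamConfig L h (x, j) =
      seamConfig L h (x, j) * seamConfig L h (x, i) := by
    simp only [seamConfig]
    split_ifs <;> simp [hcomm i j]
  rw [hab, mul_inv_cancel_right, mul_inv_cancel]

/-- Gauge transforms of flat configurations are flat. [folklore] -/
theorem plaquetteHolonomy_gaugeTransform_eq_one {U : GaugeConfig d L G}
    (hU : ∀ x i j, plaquetteHolonomy U x i j = 1) (g : Site d L → G) (x : Site d L) (i j : Fin d) :
    plaquetteHolonomy (gaugeTransform g U) x i j = 1 := by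
  rw [plaquetteHolonomy_gaugeTransform, hU, mul_one, mul_inv_cancel]

/-- Gauge transformations compose: `(U^{g'})^{g} = U^{g g'}`. [folklore] -/
theorem gaugeTransform_gaugeTransform (g g' : Site d L → G) (U : GaugeConfig d L G) :
    gaugeTransform g (gaugeTransform g' U) = gaugeTransform (fun x => g x * g' x) U := by
  funext e
  simp only [gaugeTransform, mul_inv_rev, mul_assoc]

/-- The trivial gauge transformation does nothing. [folklore] -/
theorem gaugeTransform_one (U : GaugeConfig d L G) : gaugeTransform (fun _ => (1 : G)) U = U := by
  funext e
  simp [gaugeTransform]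

/-- Undoing a gauge transformation. [folklore] -/
theorem gaugeTransform_inv_gaugeTransform (g : Site d L → G) (U : GaugeConfig d L G) :
    gaugeTransform (fun x => (g x)⁻¹) (gaugeTransform g U) = U := by
  rw [gaugeTransform_gaugeTransform]
  simp only [inv_mul_cancel]
  exact gaugeTransform_one U

/-! ## Discrete Stokes: sliding an edge across a straight line -/

/-- Flatness at the plaquette `(y; μ, ν)` in product form:
`U(y,μ) U(y+e_μ,ν) = U(y,ν) U(y+e_ν,μ)`. [folklore] -/
theorem mul_eq_mul_of_flat {U : GaugeConfig d L G} (hU : ∀ x i j, plaquetteHolonomy U x i j = 1)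
    (y : Site d L) (μ ν : Fin d) :
    U (y, μ) * U (y.shift μ, ν) = U (y, ν) * U (y.shift ν, μ) := by
  have h := hU y μ ν
  rw [plaquetteHolonomy, mul_inv_eq_one, mul_inv_eq_iff_eq_mul] at h
  exact h

/-- Shifts in two directions commute. [folklore] -/
theorem Site.shift_shift_comm (y : Site d L) (μ ν : Fin d) :
    (y.shift μ).shift ν = (y.shift ν).shift μ := by
  simp only [Site.shift, add_assoc, add_comm (Pi.single (M := fun _ => ZMod L) μ 1)]

/-- **Sliding lemma.** For a flat `U`, a step in direction `μ` slides across `n` steps in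
direction `ν`: `U(y,μ) · P_ν(n; y+e_μ) = P_ν(n; y) · U(y + n e_ν, μ)`. [folklore] -/
theorem mul_lineHolonomy_shift_eq_of_flat {U : GaugeConfig d L G}
    (hU : ∀ x i j, plaquetteHolonomy U x i j = 1) (μ ν : Fin d) :
    ∀ (n : ℕ) (y : Site d L), U (y, μ) * lineHolonomy U ν n (y.shift μ) =
      lineHolonomy U ν n y * U (y + Pi.single ν (n : ZMod L), μ)
  | 0, y => by simp [lineHolonomy]
  | n + 1, y => by
    rw [lineHolonomy, lineHolonomy, ← mul_assoc, mul_eq_mul_of_flat hU y μ ν, mul_assoc,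
      Site.shift_shift_comm y μ ν,
      mul_lineHolonomy_shift_eq_of_flat hU μ ν n (y.shift ν), mul_assoc,
      WilsonLoopRP.shift_add_single]

/-! ## The axial holonomy -/

/-- Truncation of a site: keep the coordinates `< k`, zero the others (the corner of the axial
staircase after `k` directions). [folklore] -/
def truncSite (k : ℕ) (x : Site d L) : Site d L :=
  fun i => if (i : ℕ) < k then x i else 0

/-- **Axial holonomy**: the holonomy of `U` along the lexicographic axial path from `0` towards
`x` after the first `k` directions — `x₀` steps in direction `0` (representative `(x 0).val`),
then `x₁` steps in direction `1`, and so on. The axial (maximal-tree) gauge is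
`gaugeTransform (axialHolonomy U · d) U`. [folklore] -/
def axialHolonomy (U : GaugeConfig d L G) (x : Site d L) : ℕ → G
  | 0 => 1
  | k + 1 => axialHolonomy U x k *
      (if hk : k < d then lineHolonomy U ⟨k, hk⟩ (x ⟨k, hk⟩).val (truncSite k x) else 1)

/-- No direction kept: the corner is the origin. [folklore] -/
@[simp] theorem truncSite_zero (x : Site d L) : truncSite 0 x = 0 := by
  funext i; simp [truncSite]

/-- All directions kept: the corner is the site itself. [folklore] -/
theorem truncSite_of_le {k : ℕ} (hk : d ≤ k) (x : Site d L) : truncSite k x = x := by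
  funext i; simp [truncSite, lt_of_lt_of_le i.isLt hk]

/-- One more direction: the corner moves by `x_k e_k`. [folklore] -/
theorem truncSite_succ {k : ℕ} (hk : k < d) (x : Site d L) :
    truncSite (k + 1) x = truncSite k x + Pi.single (⟨k, hk⟩ : Fin d) (x ⟨k, hk⟩) := by
  funext i
  simp only [truncSite, Pi.add_apply, Pi.single_apply]
  by_cases hi : (i : ℕ) < k
  · have : i ≠ ⟨k, hk⟩ := fun h => by subst h; exact lt_irrefl _ hi
    simp [hi, Nat.lt_succ_of_lt hi, this]
  · by_cases hik : i = ⟨k, hk⟩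
    · subst hik; simp
    · have hne : (i : ℕ) ≠ k := fun h => hik (Fin.ext h)
      have : ¬ (i : ℕ) < k + 1 := by omega
      simp [hi, this, hik]

/-- Truncation of a shifted site: the shift survives iff its direction is already kept. [folklore] -/
theorem truncSite_add_single (k : ℕ) (x : Site d L) (μ : Fin d) (c : ZMod L) :
    truncSite k (x + Pi.single μ c) =
      truncSite k x + (if (μ : ℕ) < k then Pi.single μ c else 0) := by
  funext i
  simp only [truncSite, Pi.add_apply, Pi.single_apply]
  by_cases hi : (i : ℕ) < k
  · by_cases hiμ : i = μ
    · subst hiμ; simp [hi]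
    · have : ¬ ((μ : ℕ) < k ∧ i = μ) := fun h => hiμ h.2
      split_ifs <;> simp_all
  · by_cases hμ : (μ : ℕ) < k
    · have hiμ : i ≠ μ := fun h => hi (h ▸ hμ)
      simp [hi, hμ, hiμ]
    · simp [hi, hμ]

/-- **Axial holonomy of a shifted site (discrete Stokes).** For a flat `U` and a non-wrapping
edge `(x, μ)` (`(x μ).val + 1 < L`), after `k` directions the axial holonomy towards `x + e_μ`
equals the one towards `x`, followed by the edge `(corner, μ)` as soon as direction `μ` has been
traversed. [folklore] -/
theorem axialHolonomy_add_single [NeZero L] {U : GaugeConfig d L G}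
    (hU : ∀ x i j, plaquetteHolonomy U x i j = 1) (x : Site d L) (μ : Fin d)
    (hx : (x μ).val + 1 < L) :
    ∀ k : ℕ, axialHolonomy U (x + Pi.single μ 1) k =
      axialHolonomy U x k * (if (μ : ℕ) < k then U (truncSite k x, μ) else 1)
  | 0 => by simp [axialHolonomy]
  | k + 1 => by
    have IH := axialHolonomy_add_single hU x μ hx k
    rw [axialHolonomy, axialHolonomy, IH]
    by_cases hkd : k < d
    · simp only [dif_pos hkd]
      rcases lt_trichotomy (μ : ℕ) k with hlt | heq | hgt
      · -- direction `μ` already traversed: slide the `μ`-edge across the `k`-line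
        have hμκ : μ ≠ ⟨k, hkd⟩ := fun h => by rw [h] at hlt; exact lt_irrefl _ hlt
        have hlt' : (μ : ℕ) < k + 1 := Nat.lt_succ_of_lt hlt
        rw [if_pos hlt, if_pos hlt', truncSite_add_single, if_pos hlt, truncSite_succ hkd]
        have hxκ : (x + Pi.single μ (1 : ZMod L) : Site d L) ⟨k, hkd⟩ = x ⟨k, hkd⟩ := by
          rw [Pi.add_apply, Pi.single_eq_of_ne (Ne.symm hμκ), add_zero]
        rw [hxκ, mul_assoc, ← Site.shift, mul_lineHolonomy_shift_eq_of_flat hU μ ⟨k, hkd⟩,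
          ZMod.natCast_zmod_val, mul_assoc]
      · -- direction `μ` is direction `k`: one more step at the end of the `μ`-line
        have hμκ : μ = ⟨k, hkd⟩ := Fin.ext heq
        subst hμκ
        have hlt' : ((⟨k, hkd⟩ : Fin d) : ℕ) < k + 1 := Nat.lt_succ_self k
        rw [if_neg (lt_irrefl _), if_pos hlt', mul_one, truncSite_add_single,
          if_neg (lt_irrefl _), add_zero, truncSite_succ hkd]
        have hval : ((x + Pi.single (⟨k, hkd⟩ : Fin d) (1 : ZMod L) : Site d L) ⟨k, hkd⟩).val =
            (x ⟨k, hkd⟩).val + 1 := by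
          rw [Pi.add_apply, Pi.single_eq_same]
          haveI : Fact (1 < L) := ⟨by omega⟩
          rw [ZMod.val_add_of_lt (by rw [ZMod.val_one]; exact hx), ZMod.val_one]
        rw [hval, WilsonLoopRP.lineHolonomy_succ_right, ZMod.natCast_zmod_val, mul_assoc]
      · -- direction `μ` not yet traversed: nothing changes
        have hμκ : μ ≠ ⟨k, hkd⟩ := fun h => by rw [h] at hgt; exact lt_irrefl _ hgt
        have h1 : ¬ (μ : ℕ) < k := by omega
        have h2 : ¬ (μ : ℕ) < k + 1 := by omega
        rw [if_neg h1, if_neg h2, mul_one, mul_one, truncSite_add_single, if_neg h1, add_zero]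
        have hxκ : (x + Pi.single μ (1 : ZMod L) : Site d L) ⟨k, hkd⟩ = x ⟨k, hkd⟩ := by
          rw [Pi.add_apply, Pi.single_eq_of_ne (Ne.symm hμκ), add_zero]
        rw [hxκ]
    · -- all directions traversed: both corners are `x` itself
      simp only [dif_neg hkd, mul_one]
      have hdk : d ≤ k := not_lt.1 hkd
      have h2 : (μ : ℕ) < k + 1 := by have := μ.isLt; omega
      have h3 : (μ : ℕ) < k := by have := μ.isLt; omega
      rw [if_pos h3, if_pos h2, truncSite_of_le hdk, truncSite_of_le (Nat.le_succ_of_le hdk)]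

/-- **The axial gauge trivialises non-wrapping edges.** For flat `U`, with
`T x := axialHolonomy U x d`: `T x · U(x,μ) · T(x+e_μ)⁻¹ = 1` whenever `(x μ).val + 1 < L`. [folklore] -/
theorem axialGauge_apply_of_val_lt [NeZero L] {U : GaugeConfig d L G}
    (hU : ∀ x i j, plaquetteHolonomy U x i j = 1) (x : Site d L) (μ : Fin d)
    (hx : (x μ).val + 1 < L) :
    gaugeTransform (fun y => axialHolonomy U y d) U (x, μ) = 1 := by
  have h := axialHolonomy_add_single hU x μ hx d
  rw [if_pos μ.isLt, truncSite_of_le le_rfl] at h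
  simp only [gaugeTransform, Site.shift]
  rw [h, mul_inv_rev, ← mul_assoc, mul_inv_cancel_right, mul_inv_cancel]

/-! ## Seam values in the axial gauge -/

/-- In a flat configuration whose `ν`-edges at `y` and `y + e_μ` are trivial, the `μ`-edge is
unchanged under the shift by `e_ν`. [folklore] -/
theorem apply_shift_eq_of_flat {W : GaugeConfig d L G}
    (hW : ∀ x i j, plaquetteHolonomy W x i j = 1) (y : Site d L) (μ ν : Fin d)
    (h1 : W (y, ν) = 1) (h2 : W (y.shift μ, ν) = 1) : W (y.shift ν, μ) = W (y, μ) := by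
  have h := mul_eq_mul_of_flat hW y μ ν
  rw [h2, h1, mul_one, one_mul] at h
  exact h.symm

/-- Zeroing one transverse coordinate along a seam: in the axial gauge of a flat `U`, for a
wrapping edge direction `μ` and `ν ≠ μ`, `W(z + j e_ν, μ) = W(z, μ)` for `z_ν = 0`, `j + 1 ≤ L`,
provided `(z μ).val + 1 = L`. [folklore] -/
theorem axialGauge_apply_add_single {U : GaugeConfig d L G} [NeZero L]
    (hU : ∀ x i j, plaquetteHolonomy U x i j = 1) (z : Site d L) {μ ν : Fin d} (hμν : μ ≠ ν)
    (hz : z ν = 0) :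
    ∀ j : ℕ, j + 1 ≤ L →
      gaugeTransform (fun y => axialHolonomy U y d) U (z + Pi.single ν (j : ZMod L), μ) =
        gaugeTransform (fun y => axialHolonomy U y d) U (z, μ)
  | 0, _ => by simp
  | j + 1, hj => by
    have hW : ∀ x i k, plaquetteHolonomy (gaugeTransform (fun y => axialHolonomy U y d) U) x i k = 1 :=
      plaquetteHolonomy_gaugeTransform_eq_one hU _
    have IH := axialGauge_apply_add_single hU z hμν hz j (by omega)
    rw [← IH]
    have hyν : ((z + Pi.single ν (j : ZMod L) : Site d L) ν).val = j := by
      rw [Pi.add_apply, hz, zero_add, Pi.single_eq_same, ZMod.val_natCast_of_lt (by omega)]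
    have hshift : z + Pi.single ν ((j + 1 : ℕ) : ZMod L) =
        (z + Pi.single ν (j : ZMod L) : Site d L).shift ν := by
      simp only [Site.shift, add_assoc, ← Pi.single_add]
      push_cast; rfl
    rw [hshift]
    refine apply_shift_eq_of_flat hW _ μ ν ?_ ?_
    · exact axialGauge_apply_of_val_lt hU _ ν (by rw [hyν]; omega)
    · refine axialGauge_apply_of_val_lt hU _ ν ?_
      have : ((z + Pi.single ν (j : ZMod L) : Site d L).shift μ) ν =
          (z + Pi.single ν (j : ZMod L) : Site d L) ν := by
        simp only [Site.shift, Pi.add_apply, Pi.single_eq_of_ne (Ne.symm hμν), add_zero]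
      rw [this, hyν]; omega

/-- Zeroing the first `k` transverse coordinates of a seam site. [folklore] -/
theorem axialGauge_apply_eq_truncate {U : GaugeConfig d L G} [NeZero L]
    (hU : ∀ x i j, plaquetteHolonomy U x i j = 1) (x : Site d L) (μ : Fin d) :
    ∀ k : ℕ,
      gaugeTransform (fun y => axialHolonomy U y d) U (x, μ) =
        gaugeTransform (fun y => axialHolonomy U y d) U
          ((fun i => if (i : ℕ) < k ∧ i ≠ μ then 0 else x i), μ)
  | 0 => by simp
  | k + 1 => by
    rw [axialGauge_apply_eq_truncate hU x μ k]
    by_cases hkd : k < d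
    · set κ : Fin d := ⟨k, hkd⟩
      by_cases hκμ : κ = μ
      · -- coordinate `k` is the seam direction: nothing to zero
        congr 2
        funext i
        by_cases hi : i = μ
        · subst hi; simp
        · have : ((i : ℕ) < k ∧ i ≠ μ) ↔ ((i : ℕ) < k + 1 ∧ i ≠ μ) := by
            constructor
            · rintro ⟨h, h'⟩; exact ⟨Nat.lt_succ_of_lt h, h'⟩
            · rintro ⟨h, h'⟩
              refine ⟨lt_of_le_of_ne (Nat.le_of_lt_succ h) fun hik => hi ?_, h'⟩
              rw [← hκμ]; exact Fin.ext hik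
          simp only [this]
      · -- zero coordinate `κ ≠ μ` by sliding along `κ`
        have hκk : (κ : ℕ) = k := rfl
        set z : Site d L := fun i => if (i : ℕ) < k + 1 ∧ i ≠ μ then 0 else x i with hz
        set w : Site d L := fun i => if (i : ℕ) < k ∧ i ≠ μ then 0 else x i with hw
        have hzκ : z κ = 0 := by simp [hz, hκμ, hκk]
        have hwz : w = z + Pi.single κ (((x κ).val : ℕ) : ZMod L) := by
          rw [ZMod.natCast_zmod_val]
          funext i
          simp only [hw, hz, Pi.add_apply, Pi.single_apply]
          by_cases hiκ : i = κ
          · subst hiκ; simp [hκμ, hκk]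
          · have hik : (i : ℕ) ≠ k := fun h => hiκ (Fin.ext h)
            have : ((i : ℕ) < k ∧ i ≠ μ) ↔ ((i : ℕ) < k + 1 ∧ i ≠ μ) := by
              constructor
              · rintro ⟨h, h'⟩; exact ⟨Nat.lt_succ_of_lt h, h'⟩
              · rintro ⟨h, h'⟩; exact ⟨by omega, h'⟩
            simp only [this, hiκ, if_false, add_zero]
        change gaugeTransform _ U (w, μ) = gaugeTransform _ U (z, μ)
        rw [hwz]
        exact axialGauge_apply_add_single hU z (Ne.symm hκμ) hzκ (x κ).val
          (Nat.succ_le_of_lt (ZMod.val_lt _))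
    · congr 2
      funext i
      have : ((i : ℕ) < k ∧ i ≠ μ) ↔ ((i : ℕ) < k + 1 ∧ i ≠ μ) := by
        have := i.isLt
        constructor
        · rintro ⟨h, h'⟩; exact ⟨Nat.lt_succ_of_lt h, h'⟩
        · rintro ⟨_, h'⟩; exact ⟨by omega, h'⟩
      simp only [this]

/-- **The axial gauge is constant along each seam.** For flat `U` and a wrapping edge `(x, μ)`
(`(x μ).val + 1 = L`), its value in the axial gauge is the value at the reference seam edge
`(−e_μ, μ)`. [folklore] -/
theorem axialGauge_apply_of_val_eq {U : GaugeConfig d L G} [NeZero L]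
    (hU : ∀ x i j, plaquetteHolonomy U x i j = 1) (x : Site d L) (μ : Fin d)
    (hx : (x μ).val + 1 = L) :
    gaugeTransform (fun y => axialHolonomy U y d) U (x, μ) =
      gaugeTransform (fun y => axialHolonomy U y d) U (Pi.single μ (-1), μ) := by
  rw [axialGauge_apply_eq_truncate hU x μ d]
  congr 2
  funext i
  by_cases hi : i = μ
  · subst hi
    simp only [ne_eq, not_true_eq_false, and_false, if_false, Pi.single_eq_same]
    -- `x μ = L - 1 = -1` in `ZMod L`
    have h1 : ((x i).val : ZMod L) = x i := ZMod.natCast_zmod_val (x i)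
    have h2 : (((x i).val + 1 : ℕ) : ZMod L) = 0 := by rw [hx, ZMod.natCast_self]
    push_cast at h2
    rw [← h1]
    exact eq_neg_of_add_eq_zero_left h2
  · simp [i.isLt, hi]

/-- **Seam values commute.** For flat `U`, the reference seam values
`H μ := W(−e_μ, μ)` of the axial gauge commute pairwise. [folklore] -/
theorem axialGauge_seam_comm {U : GaugeConfig d L G} [NeZero L]
    (hU : ∀ x i j, plaquetteHolonomy U x i j = 1) (μ ν : Fin d) :
    gaugeTransform (fun y => axialHolonomy U y d) U (Pi.single μ (-1), μ) *
        gaugeTransform (fun y => axialHolonomy U y d) U (Pi.single ν (-1), ν) =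
      gaugeTransform (fun y => axialHolonomy U y d) U (Pi.single ν (-1), ν) *
        gaugeTransform (fun y => axialHolonomy U y d) U (Pi.single μ (-1), μ) := by
  by_cases hμν : μ = ν
  · rw [hμν]
  set W := gaugeTransform (fun y => axialHolonomy U y d) U with hWdef
  have hW : ∀ x i k, plaquetteHolonomy W x i k = 1 := plaquetteHolonomy_gaugeTransform_eq_one hU _
  -- the plaquette at the corner `x = -e_μ - e_ν` meets both seams twice
  set x : Site d L := Pi.single μ (-1) + Pi.single ν (-1) with hx
  have hval : ∀ (y : Site d L) (i : Fin d), y i = -1 → (y i).val + 1 = L := by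
    intro y i hy
    rw [hy]
    rcases Nat.exists_eq_succ_of_ne_zero (NeZero.ne L) with ⟨m, rfl⟩
    rw [ZMod.val_neg_one]
  have h1 : W (x, μ) = W (Pi.single μ (-1), μ) :=
    axialGauge_apply_of_val_eq hU x μ (hval x μ (by simp [hx, Ne.symm hμν]))
  have h2 : W (x, ν) = W (Pi.single ν (-1), ν) :=
    axialGauge_apply_of_val_eq hU x ν (hval x ν (by simp [hx, hμν]))
  have h3 : W (x.shift μ, ν) = W (Pi.single ν (-1), ν) :=
    axialGauge_apply_of_val_eq hU (x.shift μ) ν (hval _ ν (by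
      simp [hx, Site.shift, hμν]))
  have h4 : W (x.shift ν, μ) = W (Pi.single μ (-1), μ) :=
    axialGauge_apply_of_val_eq hU (x.shift ν) μ (hval _ μ (by
      simp [hx, Site.shift, Ne.symm hμν]))
  have h := mul_eq_mul_of_flat hW x μ ν
  rw [h1, h2, h3, h4] at h
  exact h

/-! ## The structure theorem -/

/-- **Flat ⇒ gauge transform of a commuting seam configuration.** For a flat `U` on the torus
`(ℤ/L)^d` there are a site gauge `g` (the inverse axial holonomy) and a commuting tuple `h`
(the seam values of the axial gauge) with `U = gaugeTransform g (seamConfig L h)`. [folklore] -/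
theorem exists_gaugeTransform_seamConfig_of_flat [NeZero L] {U : GaugeConfig d L G}
    (hU : ∀ x i j, plaquetteHolonomy U x i j = 1) :
    ∃ (g : Site d L → G) (h : Fin d → G), (∀ μ ν, h μ * h ν = h ν * h μ) ∧
      U = gaugeTransform g (seamConfig L h) := by
  set W := gaugeTransform (fun y => axialHolonomy U y d) U with hWdef
  refine ⟨fun y => (axialHolonomy U y d)⁻¹, fun μ => W (Pi.single μ (-1), μ),
    axialGauge_seam_comm hU, ?_⟩
  have hWs : W = seamConfig L (fun μ => W (Pi.single μ (-1), μ)) := by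
    funext e
    obtain ⟨x, μ⟩ := e
    simp only [seamConfig]
    split_ifs with hx
    · exact axialGauge_apply_of_val_eq hU x μ hx
    · exact axialGauge_apply_of_val_lt hU x μ (lt_of_le_of_ne (ZMod.val_lt (x μ)) hx)
  rw [← hWs, hWdef, gaugeTransform_inv_gaugeTransform]

/-- **Flat lattice gauge fields on the discrete torus = gauge transforms of commuting seam
configurations** (toron sectors `Hom(ℤ^d, G)`; 't Hooft 1979, Lüscher 1983 §2). [folklore] -/
theorem flat_iff_exists_gaugeTransform_seamConfig [NeZero L] (U : GaugeConfig d L G) :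
    (∀ x i j, plaquetteHolonomy U x i j = 1) ↔
      ∃ (g : Site d L → G) (h : Fin d → G), (∀ μ ν, h μ * h ν = h ν * h μ) ∧
        U = gaugeTransform g (seamConfig L h) := by
  refine ⟨exists_gaugeTransform_seamConfig_of_flat, ?_⟩
  rintro ⟨g, h, hcomm, rfl⟩ x i j
  exact plaquetteHolonomy_gaugeTransform_eq_one (plaquetteHolonomy_seamConfig h hcomm) g x i j

end Literature.MathematicalPhysics.QuantumFieldTheory

end
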